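import Mathlib
import Summits.MatrixMultiplication.MatrixMultiplication.Theorems.SnSubsetDichotomyPolynomialSlackTwoEntryCap

/-!
# Pair collisions: a set of permutations routes at most `|X| + |H|²(n-2)!` of its mass through a cell set `H`

Crux `Summit.MatrixMultiplication.MatrixMultiplication.Theses.SnSubsetDichotomy.PolynomialSlack`
(item `stmt-MatrixMultiplication-8306`), level-one programme, lead c6 ("beyond one half"). For `X ⊆ S_n`
with marginals `M_X(i,j) = #{x ∈ X : x j = i}` and ANY set `H` of cells `(i,j)`:

  `Σ_{(i,j) ∈ H} M_X(i,j) ≤ |X| + |H|²·(n-2)!`      (`heavy_mass_le_card_add`).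

Proof: the left side is `Σ_{x ∈ X} W(x)` with `W(x) = #{(i,j) ∈ H : x j = i}` the number of `H`-cells hit
by `x`; `W ≤ 1 + W(W-1)` and `W(x)(W(x)-1)` counts ordered pairs of DISTINCT cells of `H` both hit by `x`;
two distinct cells are hit simultaneously by at most `(n-2)!` permutations (none if they share a row or a
column, `card_perm_apply_two_le` otherwise). Use (next files): for a quotient set `X` of co-density
`K = n!/|X|` whose heavy cells are few (`|H| ≪ n/√K`), almost every element hits AT MOST ONE heavy cell, so
the heavy mass is `≤ (1 + o(1))·|X|` — the sharp form of the heavy-mass bound that pins the hub.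
-/

-- `Summit.<Summit>.<Problem>` is the tree's mandated summit-side namespace; for this
-- single-conjunct summit the two coincide, so the file silences `dupNamespace`.
set_option linter.dupNamespace false

open scoped BigOperators

namespace Summit.MatrixMultiplication.MatrixMultiplication.Theorems.PolynomialSlack

/-- Two DISTINCT cells `p ≠ q` of `Fin n × Fin n` are hit simultaneously (`x p.2 = p.1 ∧ x q.2 = q.1`) by at
most `(n-2)!` permutations `x`: none if the cells share a column (then the values differ) and at most
`(n-2)!` if the columns differ (`card_perm_apply_two_le`). [folklore] -/
theorem card_perm_hit_two_le {n : ℕ} {p q : Fin n × Fin n} (hpq : p ≠ q) :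
    (Finset.univ.filter fun x : Equiv.Perm (Fin n) => x p.2 = p.1 ∧ x q.2 = q.1).card ≤
      (n - 2).factorial := by
  by_cases hcol : p.2 = q.2
  · have hrow : p.1 ≠ q.1 := fun h => hpq (Prod.ext h hcol)
    have he : (Finset.univ.filter fun x : Equiv.Perm (Fin n) => x p.2 = p.1 ∧ x q.2 = q.1) = ∅ :=
      Finset.filter_eq_empty_iff.2 fun x _ hx => hrow (hx.1.symm.trans (by rw [hcol]; exact hx.2))
    rw [he, Finset.card_empty]
    exact Nat.zero_le _
  · exact card_perm_apply_two_le hcol p.1 q.1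

/-- **Pair-collision bound.** For `X ⊆ S_n` and any set `H` of cells,
`Σ_{(i,j) ∈ H} #{x ∈ X : x j = i} ≤ |X| + |H|²·(n-2)!`. [folklore] -/
theorem heavy_mass_le_card_add {n : ℕ} (X : Finset (Equiv.Perm (Fin n))) (H : Finset (Fin n × Fin n)) :
    ∑ p ∈ H, (X.filter fun x => x p.2 = p.1).card ≤ X.card + H.card ^ 2 * (n - 2).factorial := by
  classical
  -- the cells of `H` hit by `x`
  set hits : Equiv.Perm (Fin n) → Finset (Fin n × Fin n) := fun x => H.filter fun p => x p.2 = p.1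
    with hhits
  -- exchange: `Σ_{p ∈ H} #{x ∈ X : x hits p} = Σ_{x ∈ X} #hits x`
  have hswap : ∑ p ∈ H, (X.filter fun x => x p.2 = p.1).card = ∑ x ∈ X, (hits x).card := by
    simp only [hhits, Finset.card_filter]
    exact Finset.sum_comm
  rw [hswap]
  -- pointwise: `W ≤ 1 + #offDiag(hits)` since `#offDiag = W² - W`
  have hpt : ∀ x, (hits x).card ≤ 1 + (hits x).offDiag.card := by
    intro x
    rw [Finset.offDiag_card]
    rcases Nat.eq_zero_or_pos (hits x).card with h0 | hpos
    · rw [h0]; simp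
    · have : (hits x).card ≤ (hits x).card * (hits x).card - (hits x).card + 1 := by
        have h1 : (hits x).card ≤ (hits x).card * (hits x).card := Nat.le_mul_self _
        have h2 : 1 * (hits x).card ≤ (hits x).card * (hits x).card := by rw [one_mul]; exact h1
        have h3 : (hits x).card * (hits x).card - (hits x).card = ((hits x).card - 1) * (hits x).card := by
          rw [Nat.sub_mul, one_mul]
        rw [h3]
        have h4 : 1 ≤ (hits x).card := hpos
        calc (hits x).card = 1 * (hits x).card := (one_mul _).symm
          _ ≤ ((hits x).card - 1) * (hits x).card + 1 := by
              rcases Nat.eq_or_lt_of_le h4 with h5 | h5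
              · rw [← h5]
              · have : 1 ≤ (hits x).card - 1 := by omega
                nlinarith
      omega
  -- the double hits are few: each ordered pair of distinct cells is hit by `≤ (n-2)!` permutations
  have hoff : ∑ x ∈ X, (hits x).offDiag.card ≤ H.card ^ 2 * (n - 2).factorial := by
    calc ∑ x ∈ X, (hits x).offDiag.card
        ≤ ∑ x : Equiv.Perm (Fin n), (hits x).offDiag.card :=
          Finset.sum_le_sum_of_subset_of_nonneg (Finset.subset_univ X) fun _ _ _ => Nat.zero_le _
      _ = ∑ x : Equiv.Perm (Fin n), ∑ pq ∈ H.offDiag, (if x pq.1.2 = pq.1.1 ∧ x pq.2.2 = pq.2.1 then 1 else 0) := by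
          refine Finset.sum_congr rfl fun x _ => ?_
          rw [Finset.card_eq_sum_ones, ← Finset.sum_filter]
          congr 1
          ext pq
          simp only [hhits, Finset.mem_offDiag, Finset.mem_filter]
          tauto
      _ = ∑ pq ∈ H.offDiag, (Finset.univ.filter fun x : Equiv.Perm (Fin n) =>
            x pq.1.2 = pq.1.1 ∧ x pq.2.2 = pq.2.1).card := by
          rw [Finset.sum_comm]
          refine Finset.sum_congr rfl fun pq _ => ?_
          rw [Finset.card_filter]
      _ ≤ ∑ _pq ∈ H.offDiag, (n - 2).factorial :=
          Finset.sum_le_sum fun pq hpq => card_perm_hit_two_le (Finset.mem_offDiag.1 hpq).2.2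
      _ = H.offDiag.card * (n - 2).factorial := by rw [Finset.sum_const, smul_eq_mul]
      _ ≤ H.card ^ 2 * (n - 2).factorial := by
          apply Nat.mul_le_mul_right
          rw [Finset.offDiag_card, sq]
          exact Nat.sub_le _ _
  calc ∑ x ∈ X, (hits x).card ≤ ∑ x ∈ X, (1 + (hits x).offDiag.card) := Finset.sum_le_sum fun x _ => hpt x
    _ = X.card + ∑ x ∈ X, (hits x).offDiag.card := by
        rw [Finset.sum_add_distrib, Finset.sum_const, smul_eq_mul, mul_one]
    _ ≤ X.card + H.card ^ 2 * (n - 2).factorial := Nat.add_le_add_left hoff _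

end Summit.MatrixMultiplication.MatrixMultiplication.Theorems.PolynomialSlack
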